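import Literature.NumberTheory.LFunctions.Zhang2022.KnifeEdgeLenZDegreeDark
import Literature.NumberTheory.LFunctions.Zhang2022.KnifeEdgeGramEndgame

/-!
# Zhang (2022), rung F-S3 (Landau–Siegel programme, §D edge len = E*-len⁺): card `z-degree-toeplitz-band`, the
# author's R1 RETYPES after the critic's A0 census — the `Z(ρ,ψ)`-GRADING (K1″, primary) and the χ-FREE slot (K1′),
# verbatim; a grading-unit-agnostic Toeplitz law; the ψ-graded slots and their POSITIVITY ENDGAME (PROVED)

Y. Zhang, *Discrete mean estimates and the Landau–Siegel zero*, arXiv:2211.02515v1 [Zhang2022LandauSiegel] —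
an unrefereed manuscript under adjudication. **WHAT THIS IS NOT: not a claim about Theorems 1–2 of
arXiv:2211.02515, about Landau–Siegel zeros, or about Parity. The programme SEARCHES and TYPES; no claim about
Landau–Siegel zeros, Theorems 1–2 of arXiv:2211.02515 or a repaired Margin232 until a kernel theorem says so.
`TauTwoLiveFree` (K1′), `TauTwoLivePsi`, `TauTwoLivePsiZhang` (K1″), `CrossTablePsi`, `DualCrossTablePsi`,
`TauTwoTablePsi` are bare `Prop`s — statement SHAPES asserted by no one; every `theorem` is finite-sum algebra or an
implication between them and the skeleton's CLAIMS `Prop22i`, `Lemma23`.**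

SOURCE: the author's R1 (ls-knife-len-idea-1 g3, 2026-08-27T01:30:04Z; `HOME/knife/len/idea-1/R1-z-degree-toeplitz-band.md`
90642c5dd9551e20, Sketch v2.2 `Sketch-z-degree-toeplitz.lean` cdfb05a9615a3c53, farm rc 0) answering the critic's A0
re-run (ls-knife-crit-1 g2, 01:11:22Z / 01:22:21Z): on `χψ`-twisted data graded by `Z(ρ,χψ)` the exact diagonal of the
`d = ±2` pattern is EMPTY (`a·m·n = D²·l₁l₂l₃`, `(mn,D) = 1 ⇒ D² ∣ a ⇒ μ(a) = 0`; conceded) — `TauTwoLive` of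
`KnifeEdgeLenZDegree` has no exact-diagonal recipe main term. The author's diagnosis: the `D²` is carried by the
GRADING UNIT `Z(ρ,ψχ) ∝ ψ(D)χ(p)τ(ψ)τ(χ)`, not by the table. Two retypes, typed here VERBATIM:
* **K1″ (primary) `TauTwoLivePsiZhang`** — grade by the root number `Z(ρ,ψ)` of `L(s,ψ)` itself (`zDegMeanPsi`,
  Gauss content `τ(ψ)^d`, no `ψ(D)`): congruence `a·m·n ≡ l₁l₂l₃ (mod p)`, exact class non-empty for Zhang's own
  `χψ` flat data in BOTH slots, `𝔞`-currency kept; variant `TauTwoLivePsi` with the free block;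
* **K1′ `TauTwoLiveFree`** — keep `Z(ρ,ψχ)`, make the graded slot χ-FREE: `freePoly N x s = Σ_{n<N} ψ(n)n^{−s}`
  (pure `ψ`, `D ∣ n` allowed — NOT `profPolyW … (conj∘χ)`, whose coefficient `χ²ψ = ψ·1_{(n,D)=1}` still empties the
  diagonal); stated scale-free (normalised correlation), with `ScaleFree`/`scaleFree_holds` (Gram entries
  bi-homogeneous ⇒ per-vector currencies immaterial to the PSD test).
The mechanism (Toeplitz law, kernel modes, P2 forcing, K3 darkness) is grading-unit-agnostic — this file makes that
a kernel statement: Part 2 types the graded mean for an ARBITRARY unit table `W(ψ,ρ)` (`zDegMeanW`; `W = Z(·,χψ)`: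
`zDegMean`; `W = Z(·,ψ)`: `zDegMeanPsi`, both by `rfl`) and proves the Toeplitz law for every `W` unimodular on the
index set (`discPolar_zTwistW`), which `Z(ρ,ψ)` is under Prop. 2.2 (i) (`norm_Zpsi_eq_one_of`, `ψ` primitive, `Re ρ = ½`).
Part 3 types the ψ-graded slots (`CrossTablePsi c' d X`, `TauTwoTablePsi c' X₂ := CrossTablePsi c' 2 X₂`,
`DualCrossTablePsi c' d Y`) on the same base tables `basePiece` and the same main-term matrix `gradedMainMatrix X₁ Y₁ X₂`
/ closing alternative `GradedCloses X₁ Y₁ X₂` of `KnifeEdgeLenZDegree` (so `KnifeEdgeLenZDegreeDark`'s Schur facts and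
`gradedForcing_or_closes` apply unchanged), and Part 4 PROVES the endgame through the generic Gram endgame
(`KnifeEdgeGramEndgame.theorem1_of_gramSlots`): `theorem1_of_gradedClosesPsi : InClassMean c' → CrossTablePsi c' 1 X₁ →
DualCrossTablePsi c' 1 Y₁ → TauTwoTablePsi c' X₂ → GradedCloses X₁ Y₁ X₂ → Prop22i → Lemma23 c' → Theorem1`.

Typer: ls-knife-typer-1 (cell landau-siegel §D).

## References
* Y. Zhang, arXiv:2211.02515v1 (2022), §2 (2.2), (2.15)–(2.17), (2.32), Lemma 2.3, Prop. 2.2 (i); §7 (7.1), Prop 7.1;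
  §8 (8.2)–(8.5), Lemma 8.1. [cite: Zhang2022LandauSiegel, §2, §7 (7.1), §8 (8.2)–(8.5)]
-/

noncomputable section

open Complex Real ComplexConjugate Matrix
open scoped ComplexOrder

namespace Literature.NumberTheory.LFunctions.Zhang2022.KnifeEdge

open Repair Skeleton

/-! ### Part 1 — the author's R1 retypes (Sketch v2.2 verbatim): χ-free block, ψ-graded mean, K1′, K1″, scale-freeness -/

section Retype

variable (c' : ℝ) {D : ℕ} [NeZero D] (χ : DirichletCharacter ℂ D)

/-- the χ-FREE flat block `Σ_{1 ≤ n < N} ψ(n)·n^{−s}` (pure `ψ`; `D ∣ n` allowed — NOT `profPolyW … χ`, whose coefficient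
`χ(n)²ψ(n)` still kills `D ∣ n`). Verbatim from Sketch v2.2. [cite: Zhang2022LandauSiegel, §2 (2.23), §7 (7.1)] -/
def freePoly (N : ℕ) (x : Chr D) (s : ℂ) : ℂ :=
  ∑ n ∈ Finset.Ico 1 N, x.ψ (n : ZMod x.p) * (n : ℂ) ^ (-s)

/-- **K1′ (crux; R1-retype of `TauTwoLive`; OPEN — asserted by no one) · `τ₂` LIVE WITH ONE χ-FREE SLOT:** the
degree-2 table between the side-3 vector `Z(ρ,ψχ)²·conj(freePoly_M)` (pure-`ψ` base) and Zhang's side-1 flat `χψ`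
polynomial of length `N`, both lengths `≤ P`, in the scale-free form the PSD test uses (normalised correlation
bounded below). Verbatim from Sketch v2.2. [cite: Zhang2022LandauSiegel, §8 (8.5), Lemma 8.1] -/
def TauTwoLiveFree : Prop :=
  ∃ c : ℝ, 0 < c ∧ ForAllLarge fun D _ χ => AssumptionA D χ →
    ∃ N M : ℕ, (N : ℝ) ≤ bigP D ∧ (M : ℝ) ≤ bigP D ∧
      c * Real.sqrt (‖zDegMean c' χ 0 (fun x s => conj (freePoly M x s)) (fun x s => conj (freePoly M x s))‖ *
            ‖zDegMean c' χ 0 (fun x s => flatPoly χ N x s) (fun x s => flatPoly χ N x s)‖) ≤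
        ‖zDegMean c' χ 2 (fun x s => conj (freePoly M x s)) (fun x s => flatPoly χ N x s)‖

/-- the `Z(ρ,ψ)`-graded mean `Σ Re 𝔠*·Z(ρ,ψ)^d·F·conj G·Re ω` (variant ″: grading by the root number of `L(s,ψ)`
itself; Gauss content `τ(ψ)^d`, no `ψ(D)` factor). Verbatim from Sketch v2.2. [cite: Zhang2022LandauSiegel, §2 (2.2), (2.16)] -/
def zDegMeanPsi (d : ℤ) (F G : Chr D → ℂ → ℂ) : ℂ :=
  ∑ i ∈ idx χ, ((cstar c' D i.1 i.2).re : ℂ) * GammaFactor.Zfac i.1.ψ i.2 ^ d *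
    (F i.1 i.2 * conj (G i.1 i.2)) * ((omegaW D i.2).re : ℂ)

/-- **K1″ with the free block (OPEN — asserted by no one):** the same scale-free lower bound for the
`Z(ρ,ψ)`-grading: exact diagonal `a·m·n = l₁l₂l₃`, no `D`-obstruction for any data. Verbatim from Sketch v2.2.
[cite: Zhang2022LandauSiegel, §8 (8.5), Lemma 8.1] -/
def TauTwoLivePsi : Prop :=
  ∃ c : ℝ, 0 < c ∧ ForAllLarge fun D _ χ => AssumptionA D χ →
    ∃ N M : ℕ, (N : ℝ) ≤ bigP D ∧ (M : ℝ) ≤ bigP D ∧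
      c * Real.sqrt (‖zDegMeanPsi c' χ 0 (fun x s => conj (freePoly M x s)) (fun x s => conj (freePoly M x s))‖ *
            ‖zDegMeanPsi c' χ 0 (fun x s => flatPoly χ N x s) (fun x s => flatPoly χ N x s)‖) ≤
        ‖zDegMeanPsi c' χ 2 (fun x s => conj (freePoly M x s)) (fun x s => flatPoly χ N x s)‖

/-- **K1″-Zhang (crux, rank 2; the PRIMARY repaired K1; OPEN — asserted by no one):** the card's K1 with the grading
unit `Z(ρ,ψχ)` replaced by `Z(ρ,ψ)` and Zhang's own `χψ` flat data in BOTH slots: exact class `a·m·n = l₁l₂l₃`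
(no `D`), two χ-contractions ⇒ `𝔞`-currency: `τ₂^ψ(conj flat_M, flat_N) ≫ 𝔞𝔓` under (A). Verbatim from Sketch v2.2.
[cite: Zhang2022LandauSiegel, §8 (8.5), Lemma 8.1, §9] -/
def TauTwoLivePsiZhang : Prop :=
  ∃ c : ℝ, 0 < c ∧ ForAllLarge fun D _ χ => AssumptionA D χ →
    ∃ N M : ℕ, (N : ℝ) ≤ bigP D ∧ (M : ℝ) ≤ bigP D ∧
      c * frakA χ * frakP D ≤
        ‖zDegMeanPsi c' χ 2 (fun x s => conj (flatPoly χ M x s)) (fun x s => flatPoly χ N x s)‖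

/-- Sanity (scale-freeness of the PSD test): rescaling the graded vectors by reals rescales every Gram entry
bi-homogeneously, so per-vector currencies are immaterial; only normalised correlations matter. Verbatim from Sketch
v2.2; PROVED below. [cite: Zhang2022LandauSiegel, §2 (2.16)–(2.17)] -/
def ScaleFree : Prop :=
  ∀ (a b : ℕ) (F G : Chr D → ℂ → ℂ) (u v : ℝ),
    gradedGram c' χ a b (fun x s => (u : ℂ) * F x s) (fun x s => (v : ℂ) * G x s) =
      (u : ℂ) * (v : ℂ) * gradedGram c' χ a b F G

/-- `ScaleFree` holds (proof from Sketch v2.2). [cite: Zhang2022LandauSiegel, §2 (2.16)–(2.17)] -/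
theorem scaleFree_holds : ScaleFree c' χ := by
  intro a b F G u v
  unfold gradedGram
  rw [Finset.mul_sum]
  refine Finset.sum_congr rfl fun i _ => ?_
  simp only [map_mul, Complex.conj_ofReal]
  ring

/-- `ScaleFree` — `_holds` alias of `scaleFree_holds` above under the fact's exact name (appended
2026-08-28, D-0026 bookkeeping: the proof term is the existing theorem of this file; no statement,
definition or attribute is edited; no new named fact; the ledger's debt table listed the fact
unproved). [cite: Zhang2022LandauSiegel, §2 (2.16)–(2.17)] -/
theorem _root_.Literature.NumberTheory.LFunctions.Zhang2022.KnifeEdge.ScaleFree_holds :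
    ScaleFree c' χ :=
  _root_.Literature.NumberTheory.LFunctions.Zhang2022.KnifeEdge.scaleFree_holds (c' := c') (χ := χ)

end Retype

/-! ### Part 2 — grading-unit-agnostic means: `zDegMeanW`, the Toeplitz law for ANY unimodular unit, `|Z(ρ,ψ)| = 1` -/

section Unit

variable (c' : ℝ) {D : ℕ} [NeZero D] (χ : DirichletCharacter ℂ D)

/-- The graded mean for an arbitrary GRADING UNIT `W(ψ,ρ)`: `Σ Re 𝔠*·W^d·F·conj G·Re ω`
(`W = Z(·,χψ)`: `zDegMean`; `W = Z(·,ψ)`: `zDegMeanPsi`). [cite: Zhang2022LandauSiegel, §2 (2.16)–(2.17)] -/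
def zDegMeanW (W : Chr D → ℂ → ℂ) (d : ℤ) (F G : Chr D → ℂ → ℂ) : ℂ :=
  ∑ i ∈ idx χ, ((cstar c' D i.1 i.2).re : ℂ) * W i.1 i.2 ^ d * (F i.1 i.2 * conj (G i.1 i.2)) * ((omegaW D i.2).re : ℂ)

/-- `zDegMean` is the instance `W = Z(·,χψ)`. [cite: Zhang2022LandauSiegel, §2 (2.2)] -/
theorem zDegMean_eq_zDegMeanW (d : ℤ) (F G : Chr D → ℂ → ℂ) :
    zDegMean c' χ d F G = zDegMeanW c' χ (Zpc χ) d F G := rfl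

omit [NeZero D] in
/-- `zDegMeanPsi` is the instance `W = Z(·,ψ)`. [cite: Zhang2022LandauSiegel, §2 (2.2)] -/
theorem zDegMeanPsi_eq_zDegMeanW (d : ℤ) (F G : Chr D → ℂ → ℂ) :
    zDegMeanPsi c' χ d F G = zDegMeanW c' χ (fun x s => GammaFactor.Zfac x.ψ s) d F G := rfl

/-- The graded test vector of degree `k` for the unit `W`: `W^k·F`. [cite: Zhang2022LandauSiegel, §2 (2.32)] -/
def zTwistW (W : Chr D → ℂ → ℂ) (k : ℕ) (F : Chr D → ℂ → ℂ) : Chr D → ℂ → ℂ := fun x t => W x t ^ k * F x t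

variable {c' χ}

omit [NeZero D] in
/-- **TOEPLITZ LAW FOR ANY UNIMODULAR UNIT (proved):** if `|W| = 1` on the index set, the tree's polar pairing of two
`W`-graded vectors is the `W`-graded mean of degree `a − b` of the bases. [cite: Zhang2022LandauSiegel, §8 (8.2)] -/
theorem discPolar_zTwistW {W : Chr D → ℂ → ℂ} (hW : ∀ i ∈ idx χ, ‖W i.1 i.2‖ = 1) (a b : ℕ)
    (F G : Chr D → ℂ → ℂ) :
    discPolar c' χ (zTwistW W a F) (zTwistW W b G) = zDegMeanW c' χ W ((a : ℤ) - (b : ℤ)) F G := by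
  unfold discPolar zDegMeanW zTwistW
  refine Finset.sum_congr rfl fun i hi => ?_
  have h1 : ‖W i.1 i.2‖ = 1 := hW i hi
  have hne : W i.1 i.2 ≠ 0 := by
    intro h0
    rw [h0, norm_zero] at h1
    exact zero_ne_one h1
  rw [map_mul, map_pow, ← Complex.inv_eq_conj h1, zpow_sub₀ hne, zpow_natCast, zpow_natCast, inv_pow]
  push_cast
  field_simp

omit [NeZero D] in
/-- With `|W| = 1` on the index set a `W`-graded vector has the discrete mean of its base. [cite: Zhang2022LandauSiegel, §8 (8.2)] -/
theorem discMean_zTwistW {W : Chr D → ℂ → ℂ} (hW : ∀ i ∈ idx χ, ‖W i.1 i.2‖ = 1) (k : ℕ) (F : Chr D → ℂ → ℂ) :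
    discMean c' χ (zTwistW W k F) = discMean c' χ F := by
  unfold discMean zTwistW
  refine Finset.sum_congr rfl fun i hi => ?_
  rw [norm_mul, norm_pow, hW i hi, one_pow, one_mul]

/-- **`|Z(ρ,ψ)| = 1` on the index set under Prop. 2.2 (i)** (`ψ` primitive, `Re ρ = ½`, `Im ρ > 0`; the root number of
`L(s,ψ)` is unimodular on the critical line). [cite: Zhang2022LandauSiegel, §2 (2.2), §8 (8.2)] -/
theorem norm_Zpsi_eq_one_of (hD : 3 ≤ D) (h22 : ∀ x ∈ PsiOne χ, ∀ s ∈ prodZeroSetOmega χ x, s.re = 1 / 2) :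
    ∀ i ∈ idx χ, ‖GammaFactor.Zfac i.1.ψ i.2‖ = 1 := by
  intro i hi
  rw [idx, Finset.mem_sigma] at hi
  have h1 : i.1 ∈ PsiOne χ := mem_of_mem_finsetOf hi.1
  have h2 : i.2 ∈ zeroSet D i.1 := mem_of_mem_finsetOf hi.2
  have hre : i.2.re = 1 / 2 := h22 i.1 h1 i.2 (mem_prodZeroSetOmega_of_mem_zeroSet χ h2)
  have him : 0 < i.2.im := im_pos_of_mem_zeroSet hD h2
  have hρ : i.2 = 1 / 2 + (i.2.im : ℂ) * I := Complex.ext (by simp [hre]) (by simp)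
  rw [hρ]
  exact GammaFactor.norm_Zfac_half_eq_one i.1.prim him

end Unit

/-! ### Part 3 — the ψ-graded pieces and SLOTS (same base tables, same main-term matrix and closing alternative) -/

section PsiSlots

variable (c' : ℝ) {D : ℕ} [NeZero D] (χ : DirichletCharacter ℂ D)

/-- The ψ-graded pieces `u_k = Z(ρ,ψ)^k·(base k)` on the base tables `(H_f, conj Q_{g₁}, conj Q_{g₂})` of
`KnifeEdgeLenZDegree.basePiece`. [cite: Zhang2022LandauSiegel, §2 (2.32)] -/
def psiGradedPiece (f g₁ g₂ : ℝ → ℂ) (k : Fin 3) : Chr D → ℂ → ℂ :=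
  zTwistW (fun x s => GammaFactor.Zfac x.ψ s) k (basePiece χ f g₁ g₂ k)

/-- The ψ-graded design `Σ_k s_k·Z(ρ,ψ)^k·(base k)`. [cite: Zhang2022LandauSiegel, §2 (2.32)] -/
def psiGradedDesign (f g₁ g₂ : ℝ → ℂ) (s : Fin 3 → ℂ) : Chr D → ℂ → ℂ := tableComb s (psiGradedPiece χ f g₁ g₂)

/-- **ψ-GRADED CROSS TABLE OF DEGREE `d` (slot shape, OPEN — asserted by no one):** under (A), eventually, for in-class
profiles `f, g`, `τ^ψ_d(conj Q_g, H_f) = Σ Re𝔠*·Z(ρ,ψ)^d·conj Q_g·conj H_f·Reω = X(f,g)·𝔞𝔓 + o(𝔞𝔓)` with a NAMED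
functional `X` (`d = 2`: K1″'s table; its formula is K1's deliverable). [cite: Zhang2022LandauSiegel, §8 (8.5), Lemma 8.1, §9] -/
def CrossTablePsi (d : ℕ) (X : PairFunctional) : Prop :=
  ∀ (f f' g g' : ℝ → ℂ), InClassPiece f f' → InClassPiece g g' → ∀ ε : ℝ, 0 < ε →
    ForAllLarge fun D _ χ => AssumptionA D χ →
      ‖zDegMeanPsi c' χ d (fun x t => conj (profPoly χ x g (⌊bigP D⌋₊ + 1) t))
            (fun x t => profPoly χ x f (⌊bigP D⌋₊ + 1) t)
          - X f f' g g' * frakA χ * frakP D‖ ≤ ε * frakA χ * frakP D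

/-- **`TauTwoTablePsi X₂`** — the named-formula slot of the ψ-graded NEW table (spec item 1 for K1″).
[cite: Zhang2022LandauSiegel, §8 (8.5), Lemma 8.1] -/
abbrev TauTwoTablePsi (X₂ : PairFunctional) : Prop := CrossTablePsi c' 2 X₂

/-- **ψ-GRADED DUAL CROSS TABLE OF DEGREE `d` (slot shape, OPEN):** `Σ Re𝔠*·Z(ρ,ψ)^d·conj Q_{g₂}·Q_{g₁}·Reω =
Y(g₁,g₂)·𝔞𝔓 + o(𝔞𝔓)` (entry `(2,1)` of the ψ-graded Gram matrix). [cite: Zhang2022LandauSiegel, §2 (2.17), §8 (8.5)] -/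
def DualCrossTablePsi (d : ℕ) (Y : PairFunctional) : Prop :=
  ∀ (g₁ g₁' g₂ g₂' : ℝ → ℂ), InClassPiece g₁ g₁' → InClassPiece g₂ g₂' → ∀ ε : ℝ, 0 < ε →
    ForAllLarge fun D _ χ => AssumptionA D χ →
      ‖zDegMeanPsi c' χ d (fun x t => conj (profPoly χ x g₂ (⌊bigP D⌋₊ + 1) t))
            (fun x t => conj (profPoly χ x g₁ (⌊bigP D⌋₊ + 1) t))
          - Y g₁ g₁' g₂ g₂' * frakA χ * frakP D‖ ≤ ε * frakA χ * frakP D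

end PsiSlots

/-! ### Part 4 — PROVED: the ψ-graded slots are Gram-entry slots; the positivity endgame via `theorem1_of_gramSlots` -/

section PsiEndgame

variable {c' : ℝ} {X₁ Y₁ X₂ : PairFunctional} {f f' g₁ g₁' g₂ g₂' : ℝ → ℂ}

/-- Every Gram entry of the ψ-graded design is a `τ^ψ_{a−b}` table once `|Z(ρ,ψ)| = 1` on the index set.
[cite: Zhang2022LandauSiegel, §2 (2.17), §8 (8.2)] -/
theorem discPolar_psiGradedPiece {D : ℕ} [NeZero D] {χ : DirichletCharacter ℂ D}
    (hW : ∀ i ∈ idx χ, ‖GammaFactor.Zfac i.1.ψ i.2‖ = 1) (f g₁ g₂ : ℝ → ℂ) (a b : Fin 3) :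
    discPolar c' χ (psiGradedPiece χ f g₁ g₂ a) (psiGradedPiece χ f g₁ g₂ b) =
      zDegMeanPsi c' χ ((a : ℕ) - (b : ℕ) : ℤ) (basePiece χ f g₁ g₂ a) (basePiece χ f g₁ g₂ b) := by
  unfold psiGradedPiece
  rw [discPolar_zTwistW (W := fun x s => GammaFactor.Zfac x.ψ s) hW, zDegMeanPsi_eq_zDegMeanW]

/-- the ψ-graded pieces of a fixed design as `D`-indexed tables. [cite: Zhang2022LandauSiegel, §2 (2.16)] -/
def psiPieceTable (f g₁ g₂ : ℝ → ℂ) (k : Fin 3) : DTable := fun D _ χ => psiGradedPiece (D := D) χ f g₁ g₂ k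

/-- a real discrete mean within `δ𝔞𝔓` of its constant, read as a complex entry estimate. [folklore] -/
private theorem entry_of_real' {x m a p δ : ℝ} (h : |x - m * a * p| ≤ δ * a * p) :
    ‖((x : ℝ) : ℂ) - (m : ℂ) * a * p‖ ≤ δ * a * p := by
  rw [← Complex.ofReal_mul, ← Complex.ofReal_mul, ← Complex.ofReal_sub, Complex.norm_real, Real.norm_eq_abs]
  exact h

/-- **Diagonal slots:** Zhang's side table (`InClassMean`) is the Gram-entry slot of every ψ-graded piece with itself
(given Prop. 2.2 (i): `|Z(ρ,ψ)| = 1`). [cite: Zhang2022LandauSiegel, §7 Prop 7.1, §8 (8.2)–(8.3)] -/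
theorem gramEntryAsymp_psi_diag (h0 : InClassMean c') (h22 : Prop22i) (hf : InClassPiece f f')
    (hg₁ : InClassPiece g₁ g₁') (hg₂ : InClassPiece g₂ g₂') (k : Fin 3) :
    GramEntryAsymp c' (psiPieceTable f g₁ g₂ k) (psiPieceTable f g₁ g₂ k)
      (gradedMainMatrix X₁ Y₁ X₂ f f' g₁ g₁' g₂ g₂' k k) := by
  -- the profile and constant on the diagonal `k`
  have hsel : ∃ (g g' : ℝ → ℂ), KinkedProfile g g' ∧
      gradedMainMatrix X₁ Y₁ X₂ f f' g₁ g₁' g₂ g₂' k k = (mainTermForm g g' : ℂ) ∧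
      ∀ (D : ℕ) [NeZero D] (χ : DirichletCharacter ℂ D),
        (basePiece χ f g₁ g₂ k = fun x t => profPoly χ x g (⌊bigP D⌋₊ + 1) t) ∨
        (basePiece χ f g₁ g₂ k = fun x t => conj (profPoly χ x g (⌊bigP D⌋₊ + 1) t)) := by
    fin_cases k
    · exact ⟨f, f', hf.kinked, rfl, fun D _ χ => Or.inl rfl⟩
    · exact ⟨g₁, g₁', hg₁.kinked, rfl, fun D _ χ => Or.inr rfl⟩
    · exact ⟨g₂, g₂', hg₂.kinked, rfl, fun D _ χ => Or.inr rfl⟩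
  obtain ⟨g, g', hg, hM, hbase⟩ := hsel
  intro ε hε
  obtain ⟨D₁, hD₁⟩ := (h0 g g' hg ε hε).and h22
  refine ⟨max D₁ 3, fun D _ χ hD hq hp hA => ?_⟩
  have hD3 : 3 ≤ D := le_trans (le_max_right _ _) hD
  obtain ⟨hmean, h22'⟩ := hD₁ D χ (le_trans (le_max_left _ _) hD) hq hp
  have hW := norm_Zpsi_eq_one_of (χ := χ) hD3 h22'
  have hdiag : discPolar c' χ (psiPieceTable f g₁ g₂ k D χ) (psiPieceTable f g₁ g₂ k D χ) =
      ((discMean c' χ (fun x t => profPoly χ x g (⌊bigP D⌋₊ + 1) t) : ℝ) : ℂ) := by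
    rw [discPolar_self]
    simp only [psiPieceTable, psiGradedPiece, discMean_zTwistW (W := fun x s => GammaFactor.Zfac x.ψ s) hW]
    rcases hbase D χ with hb | hb
    · rw [hb]
    · rw [hb, discMean_conj]
  rw [hdiag, hM]
  exact entry_of_real' (hmean hA)

/-- **Off-diagonal slots:** a ψ-graded cross / dual table of degree `a − b` is the Gram-entry slot `(a,b)` (given
Prop. 2.2 (i)). [cite: Zhang2022LandauSiegel, §2 (2.17), §8 (8.2), (8.5)] -/
theorem gramEntryAsymp_psi_offdiag (h1 : CrossTablePsi c' 1 X₁) (h21 : DualCrossTablePsi c' 1 Y₁)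
    (h2 : TauTwoTablePsi c' X₂) (h22 : Prop22i) (hf : InClassPiece f f') (hg₁ : InClassPiece g₁ g₁')
    (hg₂ : InClassPiece g₂ g₂') :
    GramEntryAsymp c' (psiPieceTable f g₁ g₂ 1) (psiPieceTable f g₁ g₂ 0)
        (gradedMainMatrix X₁ Y₁ X₂ f f' g₁ g₁' g₂ g₂' 1 0) ∧
      GramEntryAsymp c' (psiPieceTable f g₁ g₂ 2) (psiPieceTable f g₁ g₂ 0)
        (gradedMainMatrix X₁ Y₁ X₂ f f' g₁ g₁' g₂ g₂' 2 0) ∧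
      GramEntryAsymp c' (psiPieceTable f g₁ g₂ 2) (psiPieceTable f g₁ g₂ 1)
        (gradedMainMatrix X₁ Y₁ X₂ f f' g₁ g₁' g₂ g₂' 2 1) := by
  refine ⟨fun ε hε => ?_, fun ε hε => ?_, fun ε hε => ?_⟩
  · obtain ⟨D₁, hD₁⟩ := (h1 f f' g₁ g₁' hf hg₁ ε hε).and h22
    refine ⟨max D₁ 3, fun D _ χ hD hq hp hA => ?_⟩
    obtain ⟨he, h22'⟩ := hD₁ D χ (le_trans (le_max_left _ _) hD) hq hp
    have hW := norm_Zpsi_eq_one_of (χ := χ) (le_trans (le_max_right _ _) hD) h22'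
    simpa [psiPieceTable, discPolar_psiGradedPiece hW, basePiece, gradedMainMatrix] using he hA
  · obtain ⟨D₁, hD₁⟩ := (h2 f f' g₂ g₂' hf hg₂ ε hε).and h22
    refine ⟨max D₁ 3, fun D _ χ hD hq hp hA => ?_⟩
    obtain ⟨he, h22'⟩ := hD₁ D χ (le_trans (le_max_left _ _) hD) hq hp
    have hW := norm_Zpsi_eq_one_of (χ := χ) (le_trans (le_max_right _ _) hD) h22'
    simpa [psiPieceTable, discPolar_psiGradedPiece hW, basePiece, gradedMainMatrix] using he hA
  · obtain ⟨D₁, hD₁⟩ := (h21 g₁ g₁' g₂ g₂' hg₁ hg₂ ε hε).and h22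
    refine ⟨max D₁ 3, fun D _ χ hD hq hp hA => ?_⟩
    obtain ⟨he, h22'⟩ := hD₁ D χ (le_trans (le_max_left _ _) hD) hq hp
    have hW := norm_Zpsi_eq_one_of (χ := χ) (le_trans (le_max_right _ _) hD) h22'
    simpa [psiPieceTable, discPolar_psiGradedPiece hW, basePiece, gradedMainMatrix] using he hA

/-- **All nine Gram-entry slots of the ψ-graded design** from the four card slots and Prop. 2.2 (i) (upper triangle by
Hermitian symmetry). [cite: Zhang2022LandauSiegel, §2 (2.16)–(2.17)] -/
theorem gramEntryAsymp_psi (h0 : InClassMean c') (h1 : CrossTablePsi c' 1 X₁) (h21 : DualCrossTablePsi c' 1 Y₁)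
    (h2 : TauTwoTablePsi c' X₂) (h22 : Prop22i) (hf : InClassPiece f f') (hg₁ : InClassPiece g₁ g₁')
    (hg₂ : InClassPiece g₂ g₂') :
    ∀ a b, GramEntryAsymp c' (psiPieceTable f g₁ g₂ a) (psiPieceTable f g₁ g₂ b)
      (gradedMainMatrix X₁ Y₁ X₂ f f' g₁ g₁' g₂ g₂' a b) := by
  obtain ⟨e10, e20, e21⟩ := gramEntryAsymp_psi_offdiag h1 h21 h2 h22 hf hg₁ hg₂
  refine gramEntryAsymp_of_lower (gradedMainMatrix_conj_symm X₁ Y₁ X₂ f f' g₁ g₁' g₂ g₂') fun a b hba => ?_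
  fin_cases a <;> fin_cases b
  · exact gramEntryAsymp_psi_diag h0 h22 hf hg₁ hg₂ 0
  · exact absurd hba (by decide)
  · exact absurd hba (by decide)
  · exact e10
  · exact gramEntryAsymp_psi_diag h0 h22 hf hg₁ hg₂ 1
  · exact absurd hba (by decide)
  · exact e20
  · exact e21
  · exact gramEntryAsymp_psi_diag h0 h22 hf hg₁ hg₂ 2

/-- **THE ψ-GRADED ENDGAME (proved): side tables ∧ ψ-graded degree-1 tables ∧ the ψ-graded degree-2 table (K1″'s
`X₂`) ∧ a non-PSD design ∧ Prop. 2.2 (i) ∧ Lemma 2.3 ⇒ Theorem 1.** Same closing alternative `GradedCloses X₁ Y₁ X₂`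
as the `Z(·,χψ)`-graded line, so `gradedForcing_or_closes` and the `X₂ = 0` Schur facts of `KnifeEdgeLenZDegreeDark`
locate K2 verbatim. Every hypothesis OPEN / a CLAIM; nothing asserted. [cite: Zhang2022LandauSiegel, §1 Theorem 1, §2 p. 6, (2.16)] -/
theorem theorem1_of_gradedClosesPsi (h0 : InClassMean c') (h1 : CrossTablePsi c' 1 X₁) (h21 : DualCrossTablePsi c' 1 Y₁)
    (h2 : TauTwoTablePsi c' X₂) (hC : GradedCloses X₁ Y₁ X₂) (h22 : Prop22i) (h23 : Lemma23 c') : Theorem1 := by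
  obtain ⟨f, f', g₁, g₁', g₂, g₂', s, hf, hg₁, hg₂, hneg⟩ := hC
  exact theorem1_of_gramSlots (gramEntryAsymp_psi h0 h1 h21 h2 h22 hf hg₁ hg₂) hneg h22 h23

/-- … and Theorem 2. [cite: Zhang2022LandauSiegel, §1 Theorem 2] -/
theorem theorem2_of_gradedClosesPsi (h0 : InClassMean c') (h1 : CrossTablePsi c' 1 X₁) (h21 : DualCrossTablePsi c' 1 Y₁)
    (h2 : TauTwoTablePsi c' X₂) (hC : GradedCloses X₁ Y₁ X₂) (h22 : Prop22i) (h23 : Lemma23 c') : Theorem2 :=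
  Skeleton.theorem2_of_theorem1 (theorem1_of_gradedClosesPsi h0 h1 h21 h2 hC h22 h23)

end PsiEndgame

end Literature.NumberTheory.LFunctions.Zhang2022.KnifeEdge

end
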